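import Summits.QuantumAdvantage.QuantumAdvantage.Theses.RegulatorThird

/-!
# Route `RegulatorThird`: the `Assembly` item (stmt-QuantumAdvantage-15988)

The assembly item of route `RegulatorThird` is, verbatim, the chain of the route's deciding theorem `closes`
(D-0027 §2.1: its hypotheses are the route's items in order, its conclusion the summit statement), so it is
proved by `closes` itself — pure logic, no mathematical content (refuters' route passes record it as
"settled-trivial"). HONEST FRAMING: a closed ledger item, NOT summit progress (the route's cruxes are untouched).
-/

set_option linter.dupNamespace false -- D-0017: single-problem summit ⇒ `QuantumAdvantage.QuantumAdvantage` by design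

namespace Summit.QuantumAdvantage.QuantumAdvantage.Theorems.RegulatorThird

/-- **`RegulatorThird.Assembly`** (stmt-QuantumAdvantage-15988): the route's assembly chain is its deciding theorem
`closes`, uncurried verbatim. [folklore] -/
theorem Assembly_proof : Summit.QuantumAdvantage.QuantumAdvantage.Theses.RegulatorThird.Assembly := by
  unfold Summit.QuantumAdvantage.QuantumAdvantage.Theses.RegulatorThird.Assembly
  exact Summit.QuantumAdvantage.QuantumAdvantage.Theses.RegulatorThird.closes

end Summit.QuantumAdvantage.QuantumAdvantage.Theorems.RegulatorThird
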